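import Summits.CriticalPhenomena.CardyFormulaZ2.Theorems.RectilinearCardy.Negative.RectilinearCardyReductions
import Literature.Probability.RandomPlanarGeometry.ModulusSymmetry
import Literature.Probability.RandomPlanarGeometry.RectangleModulusAspectRatio

/-!
# `RectilinearCardy` (crux stmt-CriticalPhenomena-5660): the square instance and the Bollobás–Riordan rectangles (part 2)

Continuation of `RectilinearCardyReductions.lean` (negative-knowledge / structure lemmas extracted
from the standing disprover's work file `Cruxes/RectilinearCardy/Disproof.lean`, sorry-free):

* `unitSquareQuad_pt`, `crossRatio_unitSquareQuad` (the square has modulus `1/2` for every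
  uniformizing datum: reflection in the diagonal, tree `crossRatio_eq_half_of_antiAffine`),
  `modulus_unitSquareQuad`, `cardyFunction_half`, `tendsto_half_unitSquareQuad_of_rectilinearCardy`
  (crux ⇒ the critical square is crossed with probability `→ 1/2`),
  `not_rectilinearCardy_of_not_tendsto_half`, `tendsto_half_of_antiAffine` (crux ⇒ `→ 1/2` for
  every symmetric rectilinear instance), `squareCrossing_clusterPt_mem_Ioo`.
* `law_unique`, `law_half_of_tendsto_half`.
* `brHomeo`, `brRect` (the Bollobás–Riordan marked rectangle `((0,w)×(0,h); ih, 0, w, w+ih)` as a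
  `ConformalRectangle`), `brRect_carrier`, `brRect_pt`, `isRectilinear_brRect`, `exists_brRect`
  (part (a) of the sibling support `CardyMonotoneApproach.RectModulus`, proved),
  `exists_isRectilinear_modulus_eq` (rectilinear rectangles realise EVERY modulus, via the tree's
  `rectangle_crossRatio_eq_of_aspectRatio_holds`), `law_eqOn` (the crux pins the scaling function
  on all of `(0,1)`).

References: B. Bollobás, O. Riordan, *Percolation* (2006), Ch. 7 §7.1 [BollobasRiordan2006];
L. V. Ahlfors, *Complex Analysis* (1979), Ch. 4 §6.5 [AhlforsCA1979]; J. Cardy, J. Phys. A 25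
(1992) L201 [CardyJPhysA1992].
-/

noncomputable section

namespace Summit.CriticalPhenomena.CardyFormulaZ2.Theorems.RectilinearCardy.Negative

open Set Filter Topology Complex
open UpperHalfPlane (upperHalfPlaneSet)
open Literature.Probability.RandomPlanarGeometry
open Literature.Probability.Percolation (bondDomainCrossingProb unitSquareQuad rectQuad rectQuad_carrier
  unitSquareQuad_carrier)
open Summit.CriticalPhenomena.CardyFormulaZ2.Theses.CardyBoundaryCoulombGas (RectilinearCardy)

/-- The marked points of `unitSquareQuad` are its corners `(-1,-1), (1,-1), (1,1), (-1,1)`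
(read off the side descriptions `SquareModel.mem_arc_*` of the tree). [folklore] -/
theorem unitSquareQuad_pt :
    unitSquareQuad.pt 0 = ⟨-1, -1⟩ ∧ unitSquareQuad.pt 1 = ⟨1, -1⟩ ∧
      unitSquareQuad.pt 2 = ⟨1, 1⟩ ∧ unitSquareQuad.pt 3 = ⟨-1, 1⟩ :=
  rectQuad_pt _ _

/-- **The square has modulus `1/2` for EVERY uniformizing datum**: the reflection `z ↦ i z̄` in the
diagonal fixes the corners `pt 0 = (-1,-1)`, `pt 2 = (1,1)`, swaps `pt 1 ↔ pt 3` and preserves the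
square, so the tree's symmetry principle `ConformalRectangle.crossRatio_eq_half_of_antiAffine`
applies. [folklore] -/
theorem crossRatio_unitSquareQuad {φ : ConformalEquiv upperHalfPlaneSet unitSquareQuad.carrier}
    {x : Fin 4 → ℝ} (h : unitSquareQuad.IsUniformizing φ x) : crossRatio x = 1 / 2 := by
  obtain ⟨h0, h1, h2, h3⟩ := unitSquareQuad_pt
  refine ConformalRectangle.crossRatio_eq_half_of_antiAffine unitSquareQuad (u := I) (v := 0)
    (by simp) (by simp) ?_ ?_ ?_ ?_ h
  · intro z hz
    rw [unitSquareQuad_carrier, Complex.mem_reProdIm] at hz ⊢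
    simp only [antiAffine, add_zero, mul_re, I_re, conj_re, zero_mul, I_im, conj_im, one_mul,
      zero_sub, neg_neg, mul_im, zero_add, mem_Ioo] at hz ⊢
    exact ⟨hz.2, hz.1⟩
  · rw [h0]; apply Complex.ext <;> simp [antiAffine]
  · rw [h2]; apply Complex.ext <;> simp [antiAffine]
  · rw [h1, h3]; apply Complex.ext <;> simp [antiAffine]

/-- The modulus of the square is `1/2`. [folklore] -/
theorem modulus_unitSquareQuad : modulus unitSquareQuad = 1 / 2 :=
  (crossRatio_eq_modulus (isUniformizing_modulusDatum unitSquareQuad)).symm.trans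
    (crossRatio_unitSquareQuad (isUniformizing_modulusDatum unitSquareQuad))

/-- `F(1/2) = 1/2` (duality symmetry `F(1-η) = 1 - F(η)`, tree `cardyFunction_one_sub_holds`). [folklore] -/
theorem cardyFunction_half : cardyFunction (1 / 2) = 1 / 2 := by
  have h := cardyFunction_one_sub_holds (η := 1 / 2) ⟨by norm_num, by norm_num⟩
  norm_num at h
  linarith

/-- **Crux ⇒ square crossing** — the cheapest checkable consequence of the crux:
`P_{1/2}[discrete bottom arc ↔ discrete top arc of ((-1,1)²)_δ] → 1/2` as `δ → 0⁺` (for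
`δ ∈ [1/(n+1), 1/n)` the discrete domain is the full `(2n+1) × (2n+1)` vertex grid and the two
discrete arcs are its bottom and top rows: "the critical square is crossed with probability
`→ 1/2`"). Its negation would be a two-line refutation of the crux — and is false (self-duality
`crossingProb half (n+1) n = 1/2` + one-column continuity; numerics in the work file). [folklore] -/
theorem tendsto_half_unitSquareQuad_of_rectilinearCardy (h : RectilinearCardy) :
    Tendsto (bondDomainCrossingProb unitSquareQuad) (𝓝[>] 0) (𝓝 (1 / 2)) := by
  have := (hasCrossingLimit_iff_modulus.1 (h unitSquareQuad isRectilinear_unitSquareQuad))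
  rwa [modulus_unitSquareQuad, cardyFunction_half] at this

/-- Contrapositive, for the record: a proof that the square's crossing probabilities do not tend to
`1/2` refutes the crux. [folklore] -/
theorem not_rectilinearCardy_of_not_tendsto_half
    (h : ¬ Tendsto (bondDomainCrossingProb unitSquareQuad) (𝓝[>] 0) (𝓝 (1 / 2))) : ¬ RectilinearCardy :=
  fun h' ↦ h (tendsto_half_unitSquareQuad_of_rectilinearCardy h')

/-- **More kill shots of the same kind, all missing for the same reason.** For every rectilinear
conformal rectangle with an anti-conformal affine symmetry `ρ z = u z̄ + v` fixing `pt 0`, `pt 2` and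
swapping `pt 1 ↔ pt 3` (diagonal-symmetric L-shapes, crosses, staircases with symmetric marks …) the
crux predicts the limit `1/2`; when `ρ` also preserves `ℤ²` (reflection in a diagonal or an axis
through lattice points) this is exactly what self-duality + the quarter-turn symmetry give
heuristically (exactly so up to the one-column boundary layer), so none of these instances can
refute the crux. [folklore] -/
theorem tendsto_half_of_antiAffine (h : RectilinearCardy) (R : ConformalRectangle)
    (hR : IsRectilinear R) {u v : ℂ} (hu : ‖u‖ = 1) (huv : u * (starRingEnd ℂ) v + v = 0)
    (hmaps : MapsTo (antiAffine u v) R.carrier R.carrier) (h0 : antiAffine u v (R.pt 0) = R.pt 0)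
    (h2 : antiAffine u v (R.pt 2) = R.pt 2) (h1 : antiAffine u v (R.pt 1) = R.pt 3) :
    Tendsto (bondDomainCrossingProb R) (𝓝[>] 0) (𝓝 (1 / 2)) := by
  have hη : modulus R = 1 / 2 :=
    (crossRatio_eq_modulus (isUniformizing_modulusDatum R)).symm.trans
      (ConformalRectangle.crossRatio_eq_half_of_antiAffine R hu huv hmaps h0 h2 h1
        (isUniformizing_modulusDatum R))
  have := hasCrossingLimit_iff_modulus.1 (h R hR)
  rwa [hη, cardyFunction_half] at this

/-- The square's crossing probabilities have all their cluster points in `(0,1)` and `1/2` is the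
only value compatible with the lattice symmetry of the square (quarter turn + self-duality, up to
the one-column boundary effect). What the tree can prove today is the cluster-point half: [folklore] -/
theorem squareCrossing_clusterPt_mem_Ioo {c : ℝ}
    (hc : MapClusterPt c (𝓝[>] 0) (bondDomainCrossingProb unitSquareQuad)) : c ∈ Ioo 0 1 :=
  clusterPt_mem_Ioo _ hc

/-! ## §6 Natural strengthenings -/

/-- STRENGTHENING "the limit law determines `F`": if the crux holds with two candidate laws `F`, `G`
in place of `cardyFunction`, they agree at the modulus of every rectilinear rectangle (limits in a
Hausdorff space are unique and `𝓝[>] 0` is non-trivial). With Bollobás–Riordan's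
`rectangle_crossRatio_eq_of_aspectRatio` (moduli of rectangles exhaust `(0,1)`) this pins `F` on all
of `(0,1)`: the crux leaves NO freedom in the scaling function — in particular the crux for
rectangles with corner marks alone already contradicts any `F ≠ cardyFunction` there. [folklore] -/
theorem law_unique {F G : ℝ → ℝ}
    (hF : ∀ R : ConformalRectangle, IsRectilinear R → R.HasCrossingLimit (bondDomainCrossingProb R) F)
    (hG : ∀ R : ConformalRectangle, IsRectilinear R → R.HasCrossingLimit (bondDomainCrossingProb R) G)
    (R : ConformalRectangle) (hR : IsRectilinear R) : F (modulus R) = G (modulus R) :=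
  tendsto_nhds_unique (hasCrossingLimit_iff_modulus.1 (hF R hR)) (hasCrossingLimit_iff_modulus.1 (hG R hR))

/-- STRENGTHENING "some rectilinear rectangle has limit `1/2` for a law `G`" forces `G (1/2) = 1/2`
if `G` is also the law of the square: e.g. the crux is incompatible with any competitor law with
`G (1/2) ≠ 1/2` as soon as the square's limit `1/2` is known. [folklore] -/
theorem law_half_of_tendsto_half
    (hS : Tendsto (bondDomainCrossingProb unitSquareQuad) (𝓝[>] 0) (𝓝 (1 / 2))) {G : ℝ → ℝ}
    (hG : unitSquareQuad.HasCrossingLimit (bondDomainCrossingProb unitSquareQuad) G) : G (1 / 2) = 1 / 2 := by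
  have h := hasCrossingLimit_iff_modulus.1 hG
  rw [modulus_unitSquareQuad] at h
  exact tendsto_nhds_unique h hS

/-- The Bollobás–Riordan marking of a rectangle is a rotated `rectQuad`: the plane homeomorphism
`z ↦ -i z + i h`. [folklore] -/
def brHomeo (h : ℝ) : ℂ ≃ₜ ℂ :=
  (Homeomorph.mulLeft₀ (-I) (by simp)).trans (Homeomorph.addRight ((h : ℂ) * I))

/-- Formula for `brHomeo`. [folklore] -/
@[simp] theorem brHomeo_apply (h : ℝ) (z : ℂ) : brHomeo h z = -I * z + (h : ℂ) * I := rfl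

/-- **The Bollobás–Riordan rectangle** `D₄ = ((0,w)×(0,h); ih, 0, w, w+ih)` (corners marked
top-left, bottom-left, bottom-right, top-right; arc `0` = left side, crossing left ↔ right) as a
`ConformalRectangle`: the image of `rectQuad 0 h 0 w` under `brHomeo h`. This is part (a) of the
sibling support item `CardyMonotoneApproach.RectModulus` / the first conjunct of `RectGlue`. [folklore] -/
def brRect (w h : ℝ) (hw : 0 < w) (hh : 0 < h) : ConformalRectangle :=
  (rectQuad 0 h 0 w hh hw).map (brHomeo h)

/-- The carrier of the Bollobás–Riordan rectangle is `(0,w)×(0,h)`. [folklore] -/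
theorem brRect_carrier (w h : ℝ) (hw : 0 < w) (hh : 0 < h) :
    (brRect w h hw hh).carrier = Ioo (0:ℝ) w ×ℂ Ioo (0:ℝ) h := by
  ext z
  simp only [brRect, MarkedDomain.carrier_map, rectQuad_carrier, mem_image, Complex.mem_reProdIm,
    brHomeo_apply, mem_Ioo]
  constructor
  · rintro ⟨u, ⟨⟨h1, h2⟩, h3, h4⟩, rfl⟩
    simp only [add_re, neg_mul, neg_re, mul_re, I_re, zero_mul, I_im, one_mul, zero_sub, neg_neg,
      ofReal_re, ofReal_im, mul_zero, sub_zero, mul_one, add_zero, add_im, neg_im, mul_im, zero_add]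
    refine ⟨⟨h3, h4⟩, by linarith, by linarith⟩
  · rintro ⟨⟨h1, h2⟩, h3, h4⟩
    refine ⟨⟨h - z.im, z.re⟩, ⟨⟨by linarith, by linarith⟩, h1, h2⟩, ?_⟩
    apply Complex.ext <;> simp

/-- The marks of the Bollobás–Riordan rectangle are `ih, 0, w, w + ih`. [folklore] -/
theorem brRect_pt (w h : ℝ) (hw : 0 < w) (hh : 0 < h) :
    (brRect w h hw hh).pt 0 = (h:ℂ) * I ∧ (brRect w h hw hh).pt 1 = 0 ∧
      (brRect w h hw hh).pt 2 = (w:ℂ) ∧ (brRect w h hw hh).pt 3 = (w:ℂ) + (h:ℂ) * I := by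
  obtain ⟨h0, h1, h2, h3⟩ := rectQuad_pt hh hw (x₀ := 0) (y₀ := 0)
  simp only [brRect, MarkedDomain.pt_map, brHomeo_apply, h0, h1, h2, h3]
  refine ⟨?_, ?_, ?_, ?_⟩ <;> apply Complex.ext <;> simp

/-- The Bollobás–Riordan rectangle is rectilinear. [folklore] -/
theorem isRectilinear_brRect (w h : ℝ) (hw : 0 < w) (hh : 0 < h) : IsRectilinear (brRect w h hw hh) :=
  isRectilinear_of_carrier_eq hw hh (brRect_carrier w h hw hh)

/-- Part (a) of the sibling support `CardyMonotoneApproach.RectModulus` / first conjunct of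
`RectGlue`, PROVED: rectangles with the Bollobás–Riordan marks exist for all `w, h > 0`. [folklore] -/
theorem exists_brRect (w h : ℝ) (hw : 0 < w) (hh : 0 < h) :
    ∃ R : ConformalRectangle, R.carrier = Ioo (0:ℝ) w ×ℂ Ioo (0:ℝ) h ∧
      (R.pt 0 = (h:ℂ) * I ∧ R.pt 1 = 0 ∧ R.pt 2 = (w:ℂ) ∧ R.pt 3 = (w:ℂ) + (h:ℂ) * I) :=
  ⟨brRect w h hw hh, brRect_carrier w h hw hh, brRect_pt w h hw hh⟩

/-- **Rectilinear rectangles realise every modulus**: for every `η ∈ (0,1)` some Bollobás–Riordan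
rectangle has modulus `η` (tree theorem `rectangle_crossRatio_eq_of_aspectRatio_holds`,
Bollobás–Riordan Ch. 7 §7.1: the modulus is a strictly decreasing function of the aspect ratio onto
`(0,1)`). Hence the crux constrains the scaling function at EVERY argument, and is equivalent in
strength to the conjunct modulo conformal-invariance transport (next two theorems). [folklore] -/
theorem exists_isRectilinear_modulus_eq {η : ℝ} (hη : η ∈ Ioo (0:ℝ) 1) :
    ∃ R : ConformalRectangle, IsRectilinear R ∧ modulus R = η := by
  obtain ⟨g, -, himg, hall⟩ := rectangle_crossRatio_eq_of_aspectRatio_holds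
  have : η ∈ g '' Ioi 0 := himg ▸ hη
  obtain ⟨r, hr, rfl⟩ := this
  refine ⟨brRect r 1 hr one_pos, isRectilinear_brRect r 1 hr one_pos, ?_⟩
  have := hall (brRect r 1 hr one_pos) r 1 hr one_pos (brRect_carrier r 1 hr one_pos)
    (by simpa using brRect_pt r 1 hr one_pos) _ _ (isUniformizing_modulusDatum _)
  rw [div_one] at this
  exact (crossRatio_eq_modulus (isUniformizing_modulusDatum _)).symm.trans this

/-- STRENGTHENING "the limit law determines `F` on all of `(0,1)`": two scaling functions for
which the crux holds agree on `(0,1)` (`law_unique` + `exists_isRectilinear_modulus_eq`). In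
particular the crux is flatly inconsistent with any competitor `G` differing from `cardyFunction`
somewhere on `(0,1)` — e.g. with Zhang's affine law (arXiv:2206.04599 Cor. 1–2, see §8) — as a
STATEMENT; which of the two the lattice follows is what the numerics of §8 measure. [folklore] -/
theorem law_eqOn {F G : ℝ → ℝ}
    (hF : ∀ R : ConformalRectangle, IsRectilinear R → R.HasCrossingLimit (bondDomainCrossingProb R) F)
    (hG : ∀ R : ConformalRectangle, IsRectilinear R → R.HasCrossingLimit (bondDomainCrossingProb R) G) :
    EqOn F G (Ioo 0 1) := by
  intro η hη
  obtain ⟨R, hR, rfl⟩ := exists_isRectilinear_modulus_eq hη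
  exact law_unique hF hG R hR

end Summit.CriticalPhenomena.CardyFormulaZ2.Theorems.RectilinearCardy.Negative

end
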